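import Literature.MathematicalPhysics.QuantumFieldTheory.Balaban1983to89.B6SectAVectorModelV1
import Literature.MathematicalPhysics.QuantumFieldTheory.Balaban1983to89.B6Eq231
import Literature.MathematicalPhysics.QuantumFieldTheory.Balaban1983to89.B6Eq218Lagrangian

/-!
# `Balaban1983to89.B6SectACriticalPointV1` — T. Bałaban, *Propagators and renormalization transformations for lattice gauge
# theories. II*, Commun. Math. Phys. **96** (1984) 223–250 [Balaban1984PropagatorsII], Sect. A pp. 224–228 ON THE V1
# MULTI-LEVEL TORUS CALCULUS, THE CONCLUSION: the Faddeev–Popov identities **(2.31) `R∂*G∂R = R`** and **(2.34)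
# `R∂*GQ* = 0 = QG∂R`** for the CONCRETE lattice operators, ***"there exists exactly one critical configuration"*** of
# (2.5) under (2.6), (2.12), ***"given by (2.35)"*** `A = HB = GQ*(QGQ*)⁻¹B` — UNCONDITIONALLY, for every nested family of
# domains, every lattice factor `c ≠ 0`, every `B` (r03's `B6SectA.critical221_unique` and `B6Eq218Lagrangian.
# existsUnique_isCritical` with ALL hypotheses discharged) — and (2.12): *"the functional (2.8) has exactly one minimum on
# each orbit"* (`Δλ₀ = R∂*A` has exactly one solution `λ₀ ∈ N(Q′)`)

statement-level skeleton of published theorems with citation tags; proofs where landed; nothing here is a claim about the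
Yang–Mills mass gap

PDF held: `paper:balaban1984-cmp96-propagators-rt-ii` (journal page = PDF page + 222); pp. 224–228 read AS IMAGES on the ×2
renders `run/shared/lean/pub/pub-balaban/b2b-balaban-ref1/pages/1984-cmp96-propagators-rt-II/…-p002…p006-x2.png` (this seat).

CITATION HEADER (lean-in-tree rule).  Cell `lit-balaban` (HOME `run/shared/lean/pub/lit-balaban/`), PHASE-2 proof seat **p21**
(gen 5), B6 fold owner r03, referee ref-4; file 6 of 6 of r03's ranked Phase-2 target P2 «B6.Eq2.31 / B6.Eq2.34 as theorems for
the concrete lattice operators (then `B6SectA.critical221_unique` becomes unconditional)» (files: `…B6SectADomainsV1`,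
`…B6SectAZeroModesV1`, `…B6SectAOntoV1`, `…B6SectAOperatorsV1`, `…B6SectAVectorModelV1`, this file).  WHAT IS REPRODUCED:
SKELETON rows **B6.Eq2.31**, **B6.Eq2.34**, **B6.Eq2.35** (+ the sentence after it), **B6.Eq2.21**–**2.23**, **B6.Eq2.12**
(+ (2.9)–(2.11): *"this equation has exactly one solution"*), on the concrete model.  Inputs BY NAME: r03's abstract algebra
`…B6Eq231.eq231/eq234_left/eq234_right/critical221_unique_structural` and `…B6Eq218Lagrangian.existsUnique_isCritical/
isCritical_hOp/energy_hOp_le` (their hypotheses are discharged here), files 1–5.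

PRINT (pp. 225–228, verbatim).  p. 225: *"Equation (2.9) implies Δλ₀ = R∂*A, and this equation has exactly one solution …
Thus the functional (2.8) has exactly one minimum on each orbit. This minimum satisfies the equation R∂*A^{λ₀} = 0, or
R∂*A = 0 if we take A^{λ₀} as A. (2.12)"*; p. 226: *"We will prove that there exists exactly one critical configuration … we
will seek a critical point of the function h(A, λ, ω) … Δ_aA − ∂Rλ − Q*ω = 0, R∂*A = 0, QA − B = 0. (2.21) … A = G∂Rλ + GQ*ω,
(2.22) … R∂*G∂Rλ + R∂*GQ*ω = 0, QG∂Rλ + QGQ*ω = B. (2.23)"*; p. 227: *"R∂*G∂R = R. (2.31)"*; p. 228: *"R∂*GQ* = 0 = QG∂R.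
(2.34) Thus Eq. (2.23) can be simplified significantly. The first equation is simply Rλ = λ = 0, and the second is QGQ*ω = B.
… We get ω = (QGQ*)⁻¹B, and from (2.22) we obtain finally A = HB = GQ*(QGQ*)⁻¹B. (2.35) … there exists exactly one critical
configuration of (2.5) satisfying (2.6), (2.12), and given by (2.35). The only assumption we have used was the positivity of
the operator Δ_a, a > 0, or G."*

WHAT IS PROVED (0 sorry, 0 new named facts; axioms standard; every `D : Domains P`, `c ≠ 0`, weights `w > 0`).  §1 the
structural identities of Sect. A ON THE MODEL: `∂∂ = 0` on pure gauges (`dcE_comp_dE`, `curl_grad`) and its adjoint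
`∂*(∂*∂) = 0` (`dsE_comp_curlCurl`), `Q∂λ = 0` for `λ ∈ N(Q′)` (`QE_dE_eq_zero`, file 1's Lemma S), `Q′` onto ⇒ `Q′*` injective,
and the adjoint intertwining **`∂*Q* = Q′*D′`** (`dsE_comp_QsE`, with `D′ := (Q′Q′*)⁻¹Q′∂*Q*`; content: `∂*Q*ω ⊥ N(Q′)`).
§2 **(2.31)** `eq231_V1`, **(2.34)** `eq234_left_V1`/`eq234_right_V1` for the concrete operators (instances of r03's `…B6Eq231`).
§3 **(2.21) ⇒ (2.35)** `critical221_V1` (every solution of the critical-point equations has `λ = 0`, `ω = (QGQ*)⁻¹B`, `A = HB`),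
(2.22) `eq222_V1`; **`existsUnique_isCritical_V1`: `∃! A, IsCritical ∂ Q ∂* R B A`** — exactly one critical configuration of
(2.5) under (2.6), (2.12), for every `B`, with NO hypothesis left (the statement does not mention `a`; the proof runs Sect. A
with `a = 1`); `isCritical_iff_eq_hOp` (that configuration is `HB = GQ*(QGQ*)⁻¹B` for every `a > 0`) and `energy_hOp_le_V1`
(it minimises (2.5) on the admissible set).  §4 **(2.9)–(2.12)**: `existsUnique_laplace_eq_RE` (`Δλ₀ = R∂*A` has exactly one
solution in `N(Q′)`) and `existsUnique_gauge212` (exactly one `λ₀ ∈ N(Q′)` with `R∂*A^{λ₀} = 0` on each restricted orbit).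
-/

open scoped InnerProductSpace

namespace Literature.MathematicalPhysics.QuantumFieldTheory.Balaban1983to89.B6SectACriticalPointV1

open LatticeFieldCalculus B6SectADomainsV1 B6SectAZeroModesV1 B6SectAOntoV1 B6SectAOperatorsV1 B6SectAVectorModelV1
open BalabanImbrieJaffe1984to88.BIJ85AxialPropagator411 (BondSpace PlaqSpace)
open B6Eq218Lagrangian (IsCritical Admissible energy)

noncomputable section

variable {P : Params} (D : Domains P)

/-! ## §1. The structural identities of Sect. A on the model -/

/-- `∂(∂λ) = 0`: the plaquette variable of a pure gauge vanishes (`curl_grad`; p. 224 *"The functional and the conditions are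
invariant with respect to gauge transformations"*). [cite: Balaban1984PropagatorsII, (2.5)–(2.7) p.224] -/
theorem dcE_comp_dE (c : ℝ) : dcE (P := P) c ∘ₗ dE c = 0 :=
  LinearMap.ext fun f => PiLp.ext fun p => by
    rw [LinearMap.comp_apply, dcE_apply, ofLp_dE, LinearMap.zero_apply, PiLp.zero_apply]
    exact curl_grad c c (WithLp.ofLp f) p

/-- `(∂*∂)∂ = 0` (the hypothesis `C∂ = 0` of `…B6Eq231`). [cite: Balaban1984PropagatorsII, (2.28)–(2.29) p.227] -/
theorem curlCurl_comp_dE (c : ℝ) : (dcsE c ∘ₗ dcE c) ∘ₗ dE (P := P) c = 0 := by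
  rw [LinearMap.comp_assoc, dcE_comp_dE, LinearMap.comp_zero]

/-- `∂*∂* = 0` (divergence of the adjoint curl; the adjoint of `∂∂ = 0`). [cite: Balaban1984PropagatorsII, (2.32) p.227] -/
theorem dsE_comp_dcsE (c : ℝ) : dsE (P := P) c ∘ₗ dcsE c = 0 := by
  refine LinearMap.ext fun q => ?_
  have h : ∀ v : ScalarSpace P, ⟪dsE c (dcsE c q), v⟫_ℝ = 0 := fun v => by
    rw [inner_dsE_left, inner_dcsE_left, ← LinearMap.comp_apply (dcE c) (dE c), dcE_comp_dE, LinearMap.zero_apply,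
      inner_zero_right]
  exact inner_self_eq_zero.mp (h _)

/-- `∂*(∂*∂) = 0` (the hypothesis `∂*C = 0` of `…B6Eq231`: *"Let us apply the operator ∂* to both sides"*, (2.32)).
[cite: Balaban1984PropagatorsII, (2.32) p.227] -/
theorem dsE_comp_curlCurl (c : ℝ) : dsE (P := P) c ∘ₗ (dcsE c ∘ₗ dcE c) = 0 := by
  rw [← LinearMap.comp_assoc, dsE_comp_dcsE, LinearMap.zero_comp]

/-- **`Q∂λ = 0` on `𝔅` for `λ ∈ N(Q′)`** (file 1: `Q_j∂λ = ∂^{(j)}Q′_jλ` and Lemma S; p. 227 *"Q_j∂λ can be expressed in terms of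
derivatives of Q′_jλ [4]"*). [cite: Balaban1984PropagatorsII, (2.29)–(2.30) p.227] -/
theorem QE_dE_eq_zero (c : ℝ) (n : ScalarSpace P) (hn : n ∈ B6SectA.gaugeSpace (QpE D)) : QE D (dE c n) = 0 :=
  (QE_eq_zero_iff D _).mpr (by rw [ofLp_dE]; exact D.constr_zero_grad ((mem_ker_QpE_iff D n).mp hn) c)

/-- **`Q′` is onto `L²(𝔅)`** (file 3's `exists_siteAvgIter_eq_on_lamSite`). [cite: Balaban1984PropagatorsII, (2.14)–(2.17) p.225] -/
theorem QpE_surjective : Function.Surjective (QpE D) := by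
  intro ω
  obtain ⟨f, hf⟩ := exists_siteAvgIter_eq_on_lamSite D fun j y =>
    if h : j < D.k + 1 then (if hy : D.LamSite j y then ω ⟨⟨⟨j, h⟩, y⟩, hy⟩ else 0) else 0
  refine ⟨WithLp.toLp 2 f, PiLp.ext fun i => ?_⟩
  obtain ⟨⟨j, y⟩, hy⟩ := i
  rw [QpE_apply, WithLp.ofLp_toLp, hf j y hy]
  simp only [dif_pos j.2, dif_pos hy]

/-- hence `Q′*` is injective (p. 225: `(Q′G′²Q′*)⁻¹` *"is well defined"*). [cite: Balaban1984PropagatorsII, (2.17) p.225] -/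
theorem QpsE_injective : Function.Injective (QpsE D) :=
  (injective_iff_map_eq_zero _).mpr fun ω hω => by
    obtain ⟨f, hf⟩ := QpE_surjective D ω
    have h : ⟪ω, ω⟫_ℝ = 0 := by
      calc ⟪ω, ω⟫_ℝ = ⟪ω, QpE D f⟫_ℝ := by rw [hf]
        _ = ⟪QpsE D ω, f⟫_ℝ := (inner_QpsE_left D ω f).symm
        _ = 0 := by rw [hω, inner_zero_left]
    exact inner_self_eq_zero.mp h

/-- `Q′Q′*` on `L²(𝔅)`. [cite: Balaban1984PropagatorsII, (2.15)–(2.17) p.225] -/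
def qqpE : SiteIdxSpace D →ₗ[ℝ] SiteIdxSpace D := QpE D ∘ₗ QpsE D

/-- `Q′Q′*` is injective (hence invertible). [cite: Balaban1984PropagatorsII, (2.17) p.225] -/
theorem qqpE_injective : Function.Injective (qqpE D) :=
  (injective_iff_map_eq_zero _).mpr fun y hy => by
    have h : ⟪QpsE D y, QpsE D y⟫_ℝ = 0 := by
      rw [inner_QpsE_left, ← LinearMap.comp_apply (QpE D) (QpsE D)]
      change ⟪y, qqpE D y⟫_ℝ = 0
      rw [hy, inner_zero_right]
    exact QpsE_injective D (by rw [inner_self_eq_zero.mp h, map_zero])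

/-- **`D′`**, the operator on `L²(𝔅)` with `∂*Q* = Q′*D′` (the adjoint of the printed `Q∂λ = D(Q′λ)`, p. 227 / [4]); here
`D′ := (Q′Q′*)⁻¹Q′∂*Q*`. [cite: Balaban1984PropagatorsII, (2.32)–(2.33) p.227] -/
def DsE (c : ℝ) : BondIdxSpace D →ₗ[ℝ] SiteIdxSpace D :=
  ((LinearEquiv.ofInjectiveEndo (qqpE D) (qqpE_injective D)).symm : SiteIdxSpace D →ₗ[ℝ] SiteIdxSpace D) ∘ₗ
    QpE D ∘ₗ dsE c ∘ₗ QsE D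

/-- **`∂*Q* = Q′*D′`**: `∂*Q*ω` is orthogonal to `N(Q′)` (because `⟨∂*Q*ω, λ⟩ = ⟨ω, Q∂λ⟩ = 0`), hence lies in the range of
`Q′*`. [cite: Balaban1984PropagatorsII, (2.32)–(2.33) p.227] -/
theorem dsE_comp_QsE (c : ℝ) : dsE c ∘ₗ QsE D = QpsE D ∘ₗ DsE D c := by
  refine LinearMap.ext fun ω => ?_
  simp only [LinearMap.comp_apply]
  have hQ : QpE D (QpsE D (DsE D c ω)) = QpE D (dsE c (QsE D ω)) := by
    have h' := LinearMap.congr_fun (LinearEquiv.ofInjectiveEndo_right_inv (qqpE D) (qqpE_injective D))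
      (QpE D (dsE c (QsE D ω)))
    rw [Module.End.mul_apply, Module.End.one_apply] at h'
    exact h'
  have hker : dsE c (QsE D ω) - QpsE D (DsE D c ω) ∈ LinearMap.ker (QpE D) := by
    rw [LinearMap.mem_ker, map_sub, hQ, sub_self]
  have horth : ∀ n ∈ LinearMap.ker (QpE D), ⟪dsE c (QsE D ω) - QpsE D (DsE D c ω), n⟫_ℝ = 0 := fun n hn => by
    rw [inner_sub_left, inner_dsE_left, inner_QsE_left, QE_dE_eq_zero D c n hn, inner_zero_right, inner_QpsE_left,
      LinearMap.mem_ker.mp hn, inner_zero_right, sub_zero]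
  exact sub_eq_zero.mp (inner_self_eq_zero.mp (horth _ hker))

/-! ## §2. (2.31) and (2.34) for the concrete operators -/

/-- **(2.31) `R∂*G∂R = R`** for the lattice operators of Sect. A (every nested domain family, `c ≠ 0`, `a > 0`).
[cite: Balaban1984PropagatorsII, (2.31) p.227] -/
theorem eq231_V1 {c : ℝ} (hc : c ≠ 0) {w : BondIdx D → ℝ} (hw : ∀ i, 0 < w i) :
    RE D c ∘ₗ dsE c ∘ₗ GE D hc hw ∘ₗ dE c ∘ₗ RE D c = RE D c :=
  B6Eq231.eq231 (dcsE c ∘ₗ dcE c) (GE D hc hw) (dE c) (dsE c) (RE D c) (QpE D) (QE D) (QsE D) (aE D w)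
    (curlCurl_comp_dE c) (QE_dE_eq_zero D c) (RE_range D c) (RE_fix D c) (GE_comp_deltaAE D hc hw)

/-- **(2.34)₂ `QG∂R = 0`**. [cite: Balaban1984PropagatorsII, (2.34) p.228] -/
theorem eq234_right_V1 {c : ℝ} (hc : c ≠ 0) {w : BondIdx D → ℝ} (hw : ∀ i, 0 < w i) :
    QE D ∘ₗ GE D hc hw ∘ₗ dE c ∘ₗ RE D c = 0 :=
  B6Eq231.eq234_right (dcsE c ∘ₗ dcE c) (GE D hc hw) (dE c) (dsE c) (RE D c) (QpE D) (QE D) (QsE D) (aE D w)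
    (curlCurl_comp_dE c) (QE_dE_eq_zero D c) (RE_range D c) (RE_fix D c) (GE_comp_deltaAE D hc hw)

/-- **(2.34)₁ `R∂*GQ* = 0`**. [cite: Balaban1984PropagatorsII, (2.32)–(2.34) pp.227–228] -/
theorem eq234_left_V1 {c : ℝ} (hc : c ≠ 0) {w : BondIdx D → ℝ} (hw : ∀ i, 0 < w i) :
    RE D c ∘ₗ dsE c ∘ₗ GE D hc hw ∘ₗ QsE D = 0 :=
  B6Eq231.eq234_left (dcsE c ∘ₗ dcE c) (GE D hc hw) (dE c) (dsE c) (RE D c) (QpE D) (QpsE D) (DsE D c) (QE D) (QsE D)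
    (aE D w) (inner_dsE_left c) (inner_QpsE_left D) (dsE_comp_curlCurl c) (dsE_comp_QsE D c) (RE_range D c)
    (deltaAE_comp_GE D hc hw)

/-! ## §3. (2.21) ⇒ (2.35): exactly one critical configuration -/

/-- **(2.22)**: the first equation of (2.21) gives `A = G∂Rλ + GQ*ω`. [cite: Balaban1984PropagatorsII, (2.22) p.226] -/
theorem eq222_V1 {c : ℝ} (hc : c ≠ 0) {w : BondIdx D → ℝ} (hw : ∀ i, 0 < w i) {A' : BondSpace P} {lam : ScalarSpace P}
    {ω : BondIdxSpace D} (h1 : deltaAE D c w A' - dE c (RE D c lam) - QsE D ω = 0) :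
    A' = GE D hc hw (dE c (RE D c lam)) + GE D hc hw (QsE D ω) := by
  have h : deltaAE D c w A' = dE c (RE D c lam) + QsE D ω := by
    rw [sub_sub, sub_eq_zero] at h1
    exact h1
  rw [← map_add, ← h, GE_deltaAE]

/-- **(2.21) ⇒ (2.35), UNCONDITIONALLY on the model**: every solution `(A, λ, ω)`, `Rλ = λ`, of the critical-point equations
(2.21) `Δ_aA − ∂Rλ − Q*ω = 0`, `R∂*A = 0`, `QA = B` has `λ = 0`, `ω = (QGQ*)⁻¹B`, `A = HB = GQ*(QGQ*)⁻¹B` — r03's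
`B6SectA.critical221_unique` with (2.31), (2.34) and the invertibility of `Δ_a`, `QGQ*` all PROVED for the lattice operators.
[cite: Balaban1984PropagatorsII, (2.21)–(2.23) p.226 + (2.35) p.228] -/
theorem critical221_V1 {c : ℝ} (hc : c ≠ 0) {w : BondIdx D → ℝ} (hw : ∀ i, 0 < w i) {B : BondIdxSpace D}
    {A' : BondSpace P} {lam : ScalarSpace P} {ω : BondIdxSpace D} (hR : RE D c lam = lam)
    (h1 : deltaAE D c w A' - dE c (RE D c lam) - QsE D ω = 0) (h2 : RE D c (dsE c A') = 0) (h3 : QE D A' = B) :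
    lam = 0 ∧ ω = EE D hc hw B ∧ A' = B6SectA.hOp (GE D hc hw) (QsE D) (EE D hc hw) B :=
  B6Eq231.critical221_unique_structural (dcsE c ∘ₗ dcE c) (GE D hc hw) (dE c) (dsE c) (RE D c) (QpE D) (QpsE D)
    (DsE D c) (QE D) (QsE D) (aE D w) (EE D hc hw) (inner_dsE_left c) (inner_QpsE_left D) (curlCurl_comp_dE c)
    (dsE_comp_curlCurl c) (QE_dE_eq_zero D c) (dsE_comp_QsE D c) (RE_range D c) (RE_fix D c) (GE_comp_deltaAE D hc hw)
    (deltaAE_comp_GE D hc hw) (EE_comp D hc hw) hR h1 h2 h3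

/-- `HB = GQ*(QGQ*)⁻¹B` IS a critical configuration of (2.5) under (2.6), (2.12) (for every `a > 0`).
[cite: Balaban1984PropagatorsII, (2.35) p.228] -/
theorem isCritical_hOp_V1 {c : ℝ} (hc : c ≠ 0) {w : BondIdx D → ℝ} (hw : ∀ i, 0 < w i) (B : BondIdxSpace D) :
    IsCritical (dcE c) (QE D) (dsE c) (RE D c) B (B6SectA.hOp (GE D hc hw) (QsE D) (EE D hc hw) B) :=
  B6Eq218Lagrangian.isCritical_hOp (deltaAE D c w) (aE D w) (dcE c) (dcsE c) (dE c) (dsE c) (RE D c) (QE D) (QsE D) B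
    rfl (inner_dcsE_left c) (inner_dE_left c) (inner_RE_left D c) (inner_QsE_left D) (GE D hc hw) (EE D hc hw)
    (deltaAE_comp_GE D hc hw) (eq234_left_V1 D hc hw) (comp_EE D hc hw)

/-- ***"there exists exactly one critical configuration of (2.5) satisfying (2.6), (2.12)"*** — PROVED for the lattice
operators, every nested domain family, every `c ≠ 0`, every `B`, with no hypothesis left (the statement does not involve `a`;
the proof runs Sect. A with `a = 1`). [cite: Balaban1984PropagatorsII, (2.35) p.228] -/
theorem existsUnique_isCritical_V1 {c : ℝ} (hc : c ≠ 0) (B : BondIdxSpace D) :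
    ∃! x : BondSpace P, IsCritical (dcE c) (QE D) (dsE c) (RE D c) B x := by
  have hw : ∀ i : BondIdx D, 0 < (fun _ => (1 : ℝ)) i := fun _ => one_pos
  exact B6Eq218Lagrangian.existsUnique_isCritical (deltaAE D c fun _ => 1) (aE D fun _ => 1) (dcE c) (dcsE c) (dE c)
    (dsE c) (RE D c) (QE D) (QsE D) B rfl (inner_dcsE_left c) (inner_dE_left c) (inner_RE_left D c) (RE_comp_RE D c)
    (inner_QsE_left D) (GE D hc hw) (EE D hc hw) (GE_comp_deltaAE D hc hw) (deltaAE_comp_GE D hc hw)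
    (eq231_V1 D hc hw) (eq234_left_V1 D hc hw) (EE_comp D hc hw) (comp_EE D hc hw)

/-- ***"… and given by (2.35)"***: a configuration is critical iff it is `HB = GQ*(QGQ*)⁻¹B` — for EVERY choice of the
weights `a > 0` (p. 228 *"The only assumption we have used was the positivity of the operator Δ_a, a > 0, or G"*).
[cite: Balaban1984PropagatorsII, (2.35) p.228] -/
theorem isCritical_iff_eq_hOp {c : ℝ} (hc : c ≠ 0) {w : BondIdx D → ℝ} (hw : ∀ i, 0 < w i) (B : BondIdxSpace D)
    (x : BondSpace P) :
    IsCritical (dcE c) (QE D) (dsE c) (RE D c) B x ↔ x = B6SectA.hOp (GE D hc hw) (QsE D) (EE D hc hw) B :=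
  ⟨fun hx => (existsUnique_isCritical_V1 D hc B).unique hx (isCritical_hOp_V1 D hc hw B),
    fun hx => hx ▸ isCritical_hOp_V1 D hc hw B⟩

/-- *"which is of course, a minimum of the functional (2.5)"* (p. 226): `HB` minimises `‖∂A‖²` over the admissible set
`QA = B, R∂*A = 0`. [cite: Balaban1984PropagatorsII, p.226 before (2.18) + (2.35) p.228] -/
theorem energy_hOp_le_V1 {c : ℝ} (hc : c ≠ 0) {w : BondIdx D → ℝ} (hw : ∀ i, 0 < w i) (B : BondIdxSpace D)
    {y : BondSpace P} (hy : Admissible (QE D) (dsE c) (RE D c) B y) :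
    energy (dcE c) (B6SectA.hOp (GE D hc hw) (QsE D) (EE D hc hw) B) ≤ energy (dcE c) y :=
  B6Eq218Lagrangian.energy_hOp_le (deltaAE D c w) (aE D w) (dcE c) (dcsE c) (dE c) (dsE c) (RE D c) (QE D) (QsE D) B
    rfl (inner_dcsE_left c) (inner_dE_left c) (inner_RE_left D c) (inner_QsE_left D) (GE D hc hw) (EE D hc hw)
    (deltaAE_comp_GE D hc hw) (eq234_left_V1 D hc hw) (comp_EE D hc hw) hy

/-! ## §4. (2.9)–(2.12): exactly one minimum on each restricted gauge orbit -/

/-- **(2.9)–(2.11)**: *"Equation (2.9) implies Δλ₀ = R∂*A, and this equation has exactly one solution"* `λ₀ ∈ N(Q′)` — PROVED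
on the model (existence: `R∂*A ∈ ΔN(Q′)`; uniqueness: `Δ` is injective on `N(Q′)`, file 2). [cite: Balaban1984PropagatorsII, (2.9)–(2.11) p.225] -/
theorem existsUnique_laplace_eq_RE {c : ℝ} (hc : c ≠ 0) (x : BondSpace P) :
    ∃! n : ScalarSpace P, n ∈ LinearMap.ker (QpE D) ∧ lapE c n = RE D c (dsE c x) := by
  obtain ⟨n₀, hn₀, h₀⟩ := RE_range D c (dsE c x)
  refine ⟨n₀, ⟨hn₀, h₀.symm⟩, fun n hn => ?_⟩
  obtain ⟨hn, h⟩ := hn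
  have hl : laplace c (WithLp.ofLp n) = laplace c (WithLp.ofLp n₀) := by
    rw [← ofLp_lapE, ← ofLp_lapE, h, h₀]
    rfl
  exact WithLp.ofLp_injective 2
    (laplace_injOn_gaugeSpace D hc ((mem_ker_QpE_iff D n).mp hn) ((mem_ker_QpE_iff D n₀).mp hn₀) hl)

/-- **(2.12)**: *"the functional (2.8) has exactly one minimum on each orbit. This minimum satisfies the equation
R∂*A^{λ₀} = 0"* — for every `A` there is exactly one `λ₀ ∈ N(Q′)` with `R∂*(A − ∂λ₀) = 0`. [cite: Balaban1984PropagatorsII, (2.12) p.225] -/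
theorem existsUnique_gauge212 {c : ℝ} (hc : c ≠ 0) (x : BondSpace P) :
    ∃! n : ScalarSpace P, n ∈ LinearMap.ker (QpE D) ∧ RE D c (dsE c (x - dE c n)) = 0 := by
  have key : ∀ n : ScalarSpace P, n ∈ LinearMap.ker (QpE D) →
      (RE D c (dsE c (x - dE c n)) = 0 ↔ lapE c n = RE D c (dsE c x)) := fun n hn => by
    rw [map_sub, map_sub, RE_fix D c n hn, sub_eq_zero, eq_comm]
    exact Iff.rfl
  exact (existsUnique_congr fun n => and_congr_right (key n)).mpr (existsUnique_laplace_eq_RE D hc x)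

end

end Literature.MathematicalPhysics.QuantumFieldTheory.Balaban1983to89.B6SectACriticalPointV1
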